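import Summits.BirchSwinnertonDyer.BirchSwinnertonDyer.Theorems.ByReductionTypeAtTwoRankOneAtTwoBigImageOddLocalOneDoorHalvesK
import Summits.BirchSwinnertonDyer.BirchSwinnertonDyer.Theorems.ByReductionTypeAtTwoRankOneAtTwoFklDefs
import HarnessLib

/-!
# Route ByReductionTypeAtTwo, crux `RankOneAtTwoBigImageOddLocal` (stmt-BirchSwinnertonDyer-23715), LINE v8.5 `one_door_analytic`:
# the HALVES on the whole slice — the Euler-system half of `BSD₂` from a Kolyvagin UPPER bound at `2`, the fkl residue (5b)
# `ShaAnTwoIntegralOnBigImageSlice` BY NAME under it, the crux BY NAME from the two one-sided binders, and losslessness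

Width prover seat `bsd-line-fkl-p2` g8 (2026-08-28), `--supports stmt-BirchSwinnertonDyer-23715`.  THEOREMS ONLY; nothing is asserted;
BSD is not proved by any of this.  Sequel of `…OneDoorHalvesK.lean` (per-datum K-side halves, c floating).

The g7 bridge `rankOneAtTwoBigImageOddLocal_of_shaExactCAtTwo` (p624011) reads the crux off PRINT + ONE K-side binder `hXC`
(`ord₂ #Ш(E_K)[2^∞] + 2·v₂(c) = 2·M₀` on the slice's Kolyvagin-admissible Hoffstein–Luo doors) + rank-`0` `BSD₂`.  Here the binder is
SPLIT into its two inequalities and each is carried separately: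

* §1 per datum on the slice: `missingUpperBoundAt_two_of_shaUpperC_at` (`≤`-binder at ONE datum ⟹ `MissingUpperBoundAt W 2`) and
  `missingLowerBoundAt_two_of_shaLowerC_at`, with the twin's `BSD₂` from `S_rankZeroTwin` (no Manin, no odd torsion).
* §2 on the whole slice: `missingUpperBoundAt_two_onSlice_of_shaUpperCAtTwo` — **PRINT (`gross_zagier`, GZK, `exists_isNewformOf`,
  Hoffstein–Luo, Milne 1972) + `hXU` (Kolyvagin's UPPER bound at `2` over `K`, c-corrected, conductor `1`, on the Kolyvagin-admissible HL
  doors) + `S_rankZeroTwin` ⟹ `ord₂ #Ш(W) ≤ ord₂ #Ш_an(W)` for EVERY `W` on the slice of 23715**; dually `…_of_shaLowerCAtTwo`.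
* §3 `shaAnTwoIntegralOnBigImageSlice_of_shaUpperCAtTwo` — the OPEN residue (5b) of the old fkl line,
  `RankOneAtTwoFkl.ShaAnTwoIntegralOnBigImageSlice` (`…FklDefs.lean`, p606299: «`#Ш_an` is a `2`-adic integer on the slice»), BY NAME from
  the same inputs: it sits UNDER the Euler-system half (`0 ≤ ord₂ #Ш(W) ≤ ord₂ #Ш_an(W)`).
* §4 `rankOneAtTwoBigImageOddLocal_of_shaUpperC_of_shaLowerC` — the crux BY NAME from PRINT + `hXU` + `hXL` + `S_rankZeroTwin`
  (both halves ⟹ Miller's `BSD(E,2)`, the rank part and finiteness being GZK); `…_of_rankZero_cruxes` with the route's four rank-`0`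
  cruxes BY NAME in place of `S_rankZeroTwin`.
* (sequel `…OneDoorHalvesKLossless.lean`: losslessness of the split — each half of `BSD₂(W)` GIVES BACK the corresponding one-sided
  K-statement at every conductor-`1` datum, and the slice-level iffs.)

Reading for the planners.  The cone's one conjecture (AN-28c ≡ hXC ≡ `BSD₂` of the slice) splits along the classical divide into an
EULER-SYSTEM half (`hXU`: a Kolyvagin-system upper bound at `2` under full `2`-adic image — the first thing route GenusKolyvaginAtTwo's
equivariant machinery would deliver, strictly weaker than its exactness crux `KolyvaginExactAtTwo`) and a MAIN-CONJECTURE half (`hXL`: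
the `2`-adic Gross–Zagier / anticyclotomic main-conjecture direction); the Euler-system half alone already settles the fkl residue (5b).
Neither half is in print at `p = 2`.

References: [GrossLMS1991] Thm. 1.3, §2 Conj. (2.2), §4; [KolyvaginEulerSystems1990] Thm. A; [McCallumLMS1991] §1, §5;
[Milne1972ArithmeticAV] §1 Thm. 1; [Miller2011LMS] Def. 1.1.
-/

set_option autoImplicit false
-- the Theorems namespace of this sub repeats the summit name by design (D-0017 nested layout)
set_option linter.dupNamespace false

noncomputable section

open scoped Classical

namespace Summit.BirchSwinnertonDyer.BirchSwinnertonDyer.Theorems.RankOneAtTwoOneDoor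

open WeierstrassCurve NumberField Literature.NumberTheory.EllipticCurves Literature.NumberTheory.EllipticCurves.ModularForms
  Literature.NumberTheory.EllipticCurves.Rank1Residual
  Literature.NumberTheory.EllipticCurves.Rank1Residual.Typed
  Literature.NumberTheory.EllipticCurves.KrizLi2019
  Summit.BirchSwinnertonDyer.Rank1Residual
  Summit.BirchSwinnertonDyer.Rank1Residual.AdditivePotMult
  Summit.BirchSwinnertonDyer.Rank1Residual.F1Sign2
  Summit.BirchSwinnertonDyer.Rank1Residual.F1Sign2.TranspositionDoor
  Summit.BirchSwinnertonDyer.BirchSwinnertonDyer.Theses.ByReductionTypeAtTwo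
  Summit.BirchSwinnertonDyer.BirchSwinnertonDyer.Theorems.CMExactDescent
  Summit.BirchSwinnertonDyer.BirchSwinnertonDyer.Theorems.RankOneAtTwoFkl

/-! ### §1 Per datum on the slice: no Manin, no odd torsion -/


/-- The minimal twin on the slice: a globally minimal model `Cd • W^{(d_K)}`, non-CM, of analytic rank `0`, with `BSD₂` from
`S_rankZeroTwin`; and `ρ̄_{W,2}` onto from the tower hypothesis at `n = 1`. [folklore] -/
theorem exists_minimalTwin_bsdp_at
    (hGZ : ∀ (N : ℕ) [NeZero N] (W : WeierstrassCurve ℚ) (K : Type) [Field K] [NumberField K], gross_zagier N W K)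
    (hmod : hasEntireLFunction_rat) (hZ : S_rankZeroTwin)
    (W : WeierstrassCurve ℚ) [W.IsElliptic] [NeZero (W.conductorNorm ℤ)]
    (hCM : ¬ W.HasCM) (hsurj : ∀ n : ℕ, W.HasSurjectiveModNGaloisRep ((2 ^ n : ℕ) : ℤ)) (hr : W.analyticRank = 1)
    (K : Type) [Field K] [NumberField K] (hK : IsImaginaryQuadratic K) (hH : SatisfiesHeegnerHypothesis (W.conductorNorm ℤ) K)
    (Dt : ModularParametrizationData W (W.conductorNorm ℤ)) (β : ℤ) (ι : K →+* ℂ)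
    (d₁ : KolyvaginHeegnerData Dt β ι 1) (hy : ¬ IsOfFinAddOrder d₁.derivedPoint) :
    W.HasSurjectiveModNGaloisRep 2 ∧
      ∃ Cd : VariableChange ℚ, (Cd • W.quadraticTwist (NumberField.discr K : ℚ)).IsElliptic ∧
        ∃ _ : (Cd • W.quadraticTwist (NumberField.discr K : ℚ)).IsGloballyMinimal,
          BSDp (Cd • W.quadraticTwist (NumberField.discr K : ℚ)) 2 := by
  have hρ2 : W.HasSurjectiveModNGaloisRep 2 := by
    have h := hsurj 1
    norm_num at h
    exact h
  have hD0 : (NumberField.discr K : ℚ) ≠ 0 := by exact_mod_cast NumberField.discr_ne_zero K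
  haveI hEt : (W.quadraticTwist (NumberField.discr K : ℚ)).IsElliptic := W.isElliptic_quadraticTwist hD0
  obtain ⟨Cd, hCd⟩ := hasGlobalMinimalModel_rat_holds (W.quadraticTwist (NumberField.discr K : ℚ))
  haveI : (Cd • W.quadraticTwist (NumberField.discr K : ℚ)).IsGloballyMinimal := hCd
  have hCMd : ¬ (Cd • W.quadraticTwist (NumberField.discr K : ℚ)).HasCM :=
    RamifiedPairUpperBound.not_hasCM_of_smul_quadraticTwist_eq hD0 rfl hCM
  obtain ⟨hrd0, -⟩ := analyticRank_twin_and_baseChange_of_rankOne W K Dt β ι d₁ (Cd • W.quadraticTwist (NumberField.discr K : ℚ))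
    (hGZ _ W K) hmod hK hH hr hy ⟨Cd, rfl⟩
  exact ⟨hρ2, Cd, inferInstance, hCd, hZ _ hCMd hrd0⟩

/-- **The Euler-system half of `BSD₂(W)` on the slice from the `≤`-binder at ONE datum of ANY constant**: `W` globally minimal, non-CM,
`ρ_{W,2^n}` onto, odd `∏ c_ℓ`, `r_an = 1`; `K` with odd `d_K ≠ −3` and the Heegner hypothesis; ANY datum `Dt`, `β`, `ι`, conductor-`1`
datum with `y_K` non-torsion and `2^{M₀} ∥ y_K`; **`ord₂ #Ш(E_K)[2^∞] + 2·v₂(c) ≤ 2·M₀`**.  Then PRINT⁴ (`hGZ`, `hGZK`, `hmod`, `hMilneC`)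
and `S_rankZeroTwin` give `MissingUpperBoundAt W 2`. [cite: GrossLMS1991, Thm. 1.3] [cite: Milne1972ArithmeticAV, §1 Thm. 1] -/
theorem missingUpperBoundAt_two_of_shaUpperC_at
    (hGZ : ∀ (N : ℕ) [NeZero N] (W : WeierstrassCurve ℚ) (K : Type) [Field K] [NumberField K], gross_zagier N W K)
    (hGZK : rank_eq_analyticRank_of_analyticRank_le_one) (hmod : hasEntireLFunction_rat)
    (hMilneC : Milne1972.bsdQuotient_baseChange_quadratic_anyModel) (hZ : S_rankZeroTwin)
    (W : WeierstrassCurve ℚ) [W.IsElliptic] [W.IsGloballyMinimal] [NeZero (W.conductorNorm ℤ)]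
    (hCM : ¬ W.HasCM) (hsurj : ∀ n : ℕ, W.HasSurjectiveModNGaloisRep ((2 ^ n : ℕ) : ℤ)) (hc : Odd W.tamagawaProduct)
    (hr : W.analyticRank = 1)
    (K : Type) [Field K] [NumberField K] (hK : IsImaginaryQuadratic K) (hodd : Odd (NumberField.discr K))
    (h3 : NumberField.discr K ≠ -3) (hH : SatisfiesHeegnerHypothesis (W.conductorNorm ℤ) K)
    (Dt : ModularParametrizationData W (W.conductorNorm ℤ)) (β : ℤ) (ι : K →+* ℂ)
    (d₁ : KolyvaginHeegnerData Dt β ι 1) (hy : ¬ IsOfFinAddOrder d₁.derivedPoint)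
    (M₀ : ℕ)
    (hdiv : ∃ Q : (W.baseChange (ringClassField K ι 1)).toAffine.Point, ((2 ^ M₀ : ℕ) : ℤ) • Q = d₁.derivedPoint)
    (hndiv : ¬ ∃ Q : (W.baseChange (ringClassField K ι 1)).toAffine.Point,
      ((2 ^ (M₀ + 1) : ℕ) : ℤ) • Q = d₁.derivedPoint)
    (hshaU : (padicValNat 2 (Nat.card (AddCommGroup.primaryComponent (W.baseChange K).sha 2)) : ℤ) +
      2 * padicValInt 2 Dt.c ≤ 2 * M₀) :
    MissingUpperBoundAt W 2 := by
  obtain ⟨hρ2, Cd, _, _, hBd⟩ := exists_minimalTwin_bsdp_at hGZ hmod hZ W hCM hsurj hr K hK hH Dt β ι d₁ hy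
  exact missingUpperBoundAt_two_of_card_sha_baseChange_le_C_rankOne W K Dt β ι d₁ (Cd • W.quadraticTwist (NumberField.discr K : ℚ))
    (hGZ _ W K) hGZK hmod hMilneC hρ2 hc hK hodd h3 hH hr hy hdiv hndiv hshaU ⟨Cd, rfl⟩ hBd

/-- **The main-conjecture half of `BSD₂(W)` on the slice from the `≥`-binder at ONE datum of ANY constant**
(**`2·M₀ ≤ ord₂ #Ш(E_K)[2^∞] + 2·v₂(c)`** ⟹ `MissingLowerBoundAt W 2`), same setting.
[cite: GrossLMS1991, §2 Conj. (2.2)] [cite: Milne1972ArithmeticAV, §1 Thm. 1] -/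
theorem missingLowerBoundAt_two_of_shaLowerC_at
    (hGZ : ∀ (N : ℕ) [NeZero N] (W : WeierstrassCurve ℚ) (K : Type) [Field K] [NumberField K], gross_zagier N W K)
    (hGZK : rank_eq_analyticRank_of_analyticRank_le_one) (hmod : hasEntireLFunction_rat)
    (hMilneC : Milne1972.bsdQuotient_baseChange_quadratic_anyModel) (hZ : S_rankZeroTwin)
    (W : WeierstrassCurve ℚ) [W.IsElliptic] [W.IsGloballyMinimal] [NeZero (W.conductorNorm ℤ)]
    (hCM : ¬ W.HasCM) (hsurj : ∀ n : ℕ, W.HasSurjectiveModNGaloisRep ((2 ^ n : ℕ) : ℤ)) (hc : Odd W.tamagawaProduct)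
    (hr : W.analyticRank = 1)
    (K : Type) [Field K] [NumberField K] (hK : IsImaginaryQuadratic K) (hodd : Odd (NumberField.discr K))
    (h3 : NumberField.discr K ≠ -3) (hH : SatisfiesHeegnerHypothesis (W.conductorNorm ℤ) K)
    (Dt : ModularParametrizationData W (W.conductorNorm ℤ)) (β : ℤ) (ι : K →+* ℂ)
    (d₁ : KolyvaginHeegnerData Dt β ι 1) (hy : ¬ IsOfFinAddOrder d₁.derivedPoint)
    (M₀ : ℕ)
    (hdiv : ∃ Q : (W.baseChange (ringClassField K ι 1)).toAffine.Point, ((2 ^ M₀ : ℕ) : ℤ) • Q = d₁.derivedPoint)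
    (hndiv : ¬ ∃ Q : (W.baseChange (ringClassField K ι 1)).toAffine.Point,
      ((2 ^ (M₀ + 1) : ℕ) : ℤ) • Q = d₁.derivedPoint)
    (hshaL : 2 * (M₀ : ℤ) ≤ (padicValNat 2 (Nat.card (AddCommGroup.primaryComponent (W.baseChange K).sha 2)) : ℤ) +
      2 * padicValInt 2 Dt.c) :
    MissingLowerBoundAt W 2 := by
  obtain ⟨hρ2, Cd, _, _, hBd⟩ := exists_minimalTwin_bsdp_at hGZ hmod hZ W hCM hsurj hr K hK hH Dt β ι d₁ hy
  exact missingLowerBoundAt_two_of_card_sha_baseChange_ge_C_rankOne W K Dt β ι d₁ (Cd • W.quadraticTwist (NumberField.discr K : ℚ))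
    (hGZ _ W K) hGZK hmod hMilneC hρ2 hc hK hodd h3 hH hr hy hdiv hndiv hshaL ⟨Cd, rfl⟩ hBd

/-! ### §2 On the whole slice: the halves from the one-sided K-side binders on the Kolyvagin-admissible Hoffstein–Luo doors -/


/-- The common opening of the slice-level statements (g7's `rankOneAtTwoBigImageOddLocal_of_shaExactCAtTwo`): for `W` on the slice there
are a Kolyvagin-admissible door field `K` (odd `d_K ≠ −3`, Heegner, the two non-square conditions, `L(W^{(d_K)},1) ≠ 0`:
`exists_kolyvaginDoorField_of_analyticRank_eq_one`, p622543), a datum `Dt` (modularity), `β`, `ι`, a conductor-`1` datum `d₁` with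
`y_K` of infinite order (Gross–Zagier) and its exact exponent `M₀`. [cite: GrossZagier1986, V.§2] [cite: GrossLMS1991, §4] -/
theorem exists_kolyvaginDoorDatum_of_onSlice
    (hGZ : ∀ (N : ℕ) [NeZero N] (W : WeierstrassCurve ℚ) (K : Type) [Field K] [NumberField K], gross_zagier N W K)
    (hnf : exists_isNewformOf) (hHL : HoffsteinLuo1997_exists_twist_L_one_ne_zero)
    (W : WeierstrassCurve ℚ) [W.IsElliptic] [W.IsGloballyMinimal] [NeZero (W.conductorNorm ℤ)] (hr : W.analyticRank = 1) :
    ∃ (K : Type) (_ : Field K) (_ : NumberField K), IsImaginaryQuadratic K ∧ Odd (NumberField.discr K) ∧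
      NumberField.discr K ≠ -3 ∧ SatisfiesHeegnerHypothesis (W.conductorNorm ℤ) K ∧
      ¬ IsSquare ((NumberField.discr K : ℚ) * -|W.Δ|) ∧ ¬ IsSquare ((NumberField.discr K : ℚ) * (-(2 * |W.Δ|))) ∧
      ∃ (Dt : ModularParametrizationData W (W.conductorNorm ℤ)) (β : ℤ) (ι : K →+* ℂ) (d₁ : KolyvaginHeegnerData Dt β ι 1)
        (M₀ : ℕ), ¬ IsOfFinAddOrder d₁.derivedPoint ∧
        (∃ Q : (W.baseChange (ringClassField K ι 1)).toAffine.Point, ((2 ^ M₀ : ℕ) : ℤ) • Q = d₁.derivedPoint) ∧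
        ¬ ∃ Q : (W.baseChange (ringClassField K ι 1)).toAffine.Point, ((2 ^ (M₀ + 1) : ℕ) : ℤ) • Q = d₁.derivedPoint := by
  have hmod : hasEntireLFunction_rat := hasEntireLFunction_rat_of_exists_isNewformOf hnf
  obtain ⟨K, _iF, _iN, hK, hodd, h3, hH, hsq1, hsq2, -, hLt, -⟩ :=
    exists_kolyvaginDoorField_of_analyticRank_eq_one hnf hHL W hr
  obtain ⟨Dt⟩ := (nonempty_modularParametrizationData_iff_exists_isNewformOf_unconditional.mpr hnf) W
  obtain ⟨β, hβ⟩ : ∃ β : ℤ, (4 * (W.conductorNorm ℤ : ℕ) : ℤ) ∣ β ^ 2 - NumberField.discr K :=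
    Literature.NumberTheory.QuadraticFields.Quadratic.exists_dvd_sq_sub_discr_of_ncard_primesOver hK.1 (NeZero.ne _) hH
  obtain ⟨ι⟩ : Nonempty (K →+* ℂ) := inferInstance
  obtain ⟨d₁⟩ := exists_kolyvaginHeegnerData_one
    (phi_heegnerTau_mem_singularModuliField_holds (W.conductorNorm ℤ) W K) hK Dt β ι hβ
  haveI hEK : (W.baseChange K).IsElliptic := isElliptic_baseChange' W K
  have hL0 : W.entireLFunction 1 = 0 := entireLFunction_one_eq_zero_of_analyticRank_eq_one hr
  obtain ⟨-, hderiv⟩ := leadingLCoeff_eq_deriv_of_analyticRank_eq_one hr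
  have hLK : LDerivEK W K ≠ 0 := by
    rw [lDerivEK_eq_deriv_mul W K hmod hL0]; exact mul_ne_zero hderiv hLt
  obtain ⟨P₀, Hd, hP₀, hP₀K⟩ := exists_heegnerPoint_map_eq_derivedPoint_one hK hH d₁
  have hP₀inf : ¬ IsOfFinAddOrder P₀ :=
    (lDerivEK_ne_zero_iff_not_isOfFinAddOrder W (W.conductorNorm ℤ) K (hGZ _ W K) hK hH ⟨Dt, Hd, ι, hP₀⟩).mp hLK
  have hy : ¬ IsOfFinAddOrder d₁.derivedPoint := by
    intro hfin
    apply hP₀inf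
    rw [← hP₀K] at hfin
    exact (WeierstrassCurve.Affine.Point.map_injective (W' := W) _).isOfFinAddOrder_iff.mp hfin
  obtain ⟨M₀, hdiv, hndiv⟩ : ∃ M₀ : ℕ,
      (∃ Q : (W.baseChange (ringClassField K ι 1)).toAffine.Point, ((2 ^ M₀ : ℕ) : ℤ) • Q = d₁.derivedPoint) ∧
      ¬ ∃ Q : (W.baseChange (ringClassField K ι 1)).toAffine.Point, ((2 ^ (M₀ + 1) : ℕ) : ℤ) • Q = d₁.derivedPoint := by
    haveI : NumberField (ringClassField K ι 1) := numberField_ringClassField hK ι one_ne_zero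
    haveI : (W.baseChange (ringClassField K ι 1)).IsElliptic := by rw [baseChange]; infer_instance
    haveI : Module.Finite ℤ (W.baseChange (ringClassField K ι 1)).toAffine.Point := by
      convert (W.baseChange (ringClassField K ι 1)).module_finite_point_holds
    exact exists_pow_smul_eq_and_not_of_not_isOfFinAddOrder Nat.prime_two hy
  exact ⟨K, _iF, _iN, hK, hodd, h3, hH, hsq1, hsq2, Dt, β, ι, d₁, M₀, hy, hdiv, hndiv⟩

/-- **THE EULER-SYSTEM HALF OF `BSD₂` ON THE WHOLE SLICE OF 23715 FROM KOLYVAGIN'S UPPER BOUND AT `2` OVER `K`.**  Binders: PRINT —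
Gross–Zagier (`hGZ`), GZK (`hGZK`), modularity as a newform (`hnf`), Hoffstein–Luo 1997 (`hHL`), Milne 1972 (`hMilneC`); `hXU` — for `W`
on the slice, `K` with odd `d_K ≠ −3`, Heegner, `d_K·(−|Δ|)`, `d_K·(−2|Δ|)` non-squares, EVERY datum `Dt` (any constant), `β`, `ι`,
conductor-`1` datum with `y_K` of infinite order and exact exponent `M₀`: **`ord₂ #Ш(E_K)[2^∞] + 2·v₂(c_{Dt}) ≤ 2·M₀`**; and
`S_rankZeroTwin`.  THEN `ord₂ #Ш(W) ≤ ord₂ #Ш_an(W)` (`MissingUpperBoundAt W 2`) for every non-CM globally minimal `W` with `ρ_{W,2^n}`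
onto for all `n`, odd torsion, odd Tamagawa product and analytic rank `1`.  Conditional by design; BSD is not proved by this.
[cite: GrossLMS1991, Thm. 1.3 and §4] [cite: KolyvaginEulerSystems1990, Thm. A] -/
theorem missingUpperBoundAt_two_onSlice_of_shaUpperCAtTwo
    (hGZ : ∀ (N : ℕ) [NeZero N] (W : WeierstrassCurve ℚ) (K : Type) [Field K] [NumberField K], gross_zagier N W K)
    (hGZK : rank_eq_analyticRank_of_analyticRank_le_one) (hnf : exists_isNewformOf)
    (hHL : HoffsteinLuo1997_exists_twist_L_one_ne_zero) (hMilneC : Milne1972.bsdQuotient_baseChange_quadratic_anyModel)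
    (hXU : ∀ (W : WeierstrassCurve ℚ) [W.IsElliptic] [W.IsGloballyMinimal] [NeZero (W.conductorNorm ℤ)],
      ¬ W.HasCM → (∀ n : ℕ, W.HasSurjectiveModNGaloisRep ((2 ^ n : ℕ) : ℤ)) → Odd W.tamagawaProduct → W.analyticRank = 1 →
      ∀ (K : Type) [Field K] [NumberField K], IsImaginaryQuadratic K → Odd (NumberField.discr K) →
        NumberField.discr K ≠ -3 → SatisfiesHeegnerHypothesis (W.conductorNorm ℤ) K →
        ¬ IsSquare ((NumberField.discr K : ℚ) * -|W.Δ|) → ¬ IsSquare ((NumberField.discr K : ℚ) * (-(2 * |W.Δ|))) →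
        ∀ (Dt : ModularParametrizationData W (W.conductorNorm ℤ)) (β : ℤ) (ι : K →+* ℂ) (d₁ : KolyvaginHeegnerData Dt β ι 1),
          ¬ IsOfFinAddOrder d₁.derivedPoint → ∀ (M₀ : ℕ),
          (∃ Q : (W.baseChange (ringClassField K ι 1)).toAffine.Point, ((2 ^ M₀ : ℕ) : ℤ) • Q = d₁.derivedPoint) →
          (¬ ∃ Q : (W.baseChange (ringClassField K ι 1)).toAffine.Point, ((2 ^ (M₀ + 1) : ℕ) : ℤ) • Q = d₁.derivedPoint) →
          (padicValNat 2 (Nat.card (AddCommGroup.primaryComponent (W.baseChange K).sha 2)) : ℤ) + 2 * padicValInt 2 Dt.c ≤ 2 * M₀)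
    (hZ : S_rankZeroTwin) :
    ∀ (W : WeierstrassCurve ℚ) [W.IsElliptic] [W.IsGloballyMinimal], ¬ W.HasCM →
      (∀ n : ℕ, W.HasSurjectiveModNGaloisRep ((2 ^ n : ℕ) : ℤ)) → Odd W.torsionOrder → Odd W.tamagawaProduct →
      W.analyticRank = 1 → MissingUpperBoundAt W 2 := by
  intro W _ _ hCM hsurj _hT hc hr
  haveI hN : NeZero (W.conductorNorm ℤ) := ⟨(W.conductorNorm_pos_holds).ne'⟩
  have hmod : hasEntireLFunction_rat := hasEntireLFunction_rat_of_exists_isNewformOf hnf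
  obtain ⟨K, _iF, _iN, hK, hodd, h3, hH, hsq1, hsq2, Dt, β, ι, d₁, M₀, hy, hdiv, hndiv⟩ :=
    exists_kolyvaginDoorDatum_of_onSlice hGZ hnf hHL W hr
  have hshaU := hXU W hCM hsurj hc hr K hK hodd h3 hH hsq1 hsq2 Dt β ι d₁ hy M₀ hdiv hndiv
  exact missingUpperBoundAt_two_of_shaUpperC_at hGZ hGZK hmod hMilneC hZ W hCM hsurj hc hr K hK hodd h3 hH Dt β ι d₁ hy M₀ hdiv hndiv
    hshaU

/-- **THE MAIN-CONJECTURE HALF OF `BSD₂` ON THE WHOLE SLICE from the `≥`-binder `hXL`** (`2·M₀ ≤ ord₂ #Ш(E_K)[2^∞] + 2·v₂(c)` on the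
same doors), PRINT and `S_rankZeroTwin`: `MissingLowerBoundAt W 2` for every `W` on the slice.  Conditional by design.
[cite: GrossLMS1991, §2 Conj. (2.2) and §4] -/
theorem missingLowerBoundAt_two_onSlice_of_shaLowerCAtTwo
    (hGZ : ∀ (N : ℕ) [NeZero N] (W : WeierstrassCurve ℚ) (K : Type) [Field K] [NumberField K], gross_zagier N W K)
    (hGZK : rank_eq_analyticRank_of_analyticRank_le_one) (hnf : exists_isNewformOf)
    (hHL : HoffsteinLuo1997_exists_twist_L_one_ne_zero) (hMilneC : Milne1972.bsdQuotient_baseChange_quadratic_anyModel)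
    (hXL : ∀ (W : WeierstrassCurve ℚ) [W.IsElliptic] [W.IsGloballyMinimal] [NeZero (W.conductorNorm ℤ)],
      ¬ W.HasCM → (∀ n : ℕ, W.HasSurjectiveModNGaloisRep ((2 ^ n : ℕ) : ℤ)) → Odd W.tamagawaProduct → W.analyticRank = 1 →
      ∀ (K : Type) [Field K] [NumberField K], IsImaginaryQuadratic K → Odd (NumberField.discr K) →
        NumberField.discr K ≠ -3 → SatisfiesHeegnerHypothesis (W.conductorNorm ℤ) K →
        ¬ IsSquare ((NumberField.discr K : ℚ) * -|W.Δ|) → ¬ IsSquare ((NumberField.discr K : ℚ) * (-(2 * |W.Δ|))) →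
        ∀ (Dt : ModularParametrizationData W (W.conductorNorm ℤ)) (β : ℤ) (ι : K →+* ℂ) (d₁ : KolyvaginHeegnerData Dt β ι 1),
          ¬ IsOfFinAddOrder d₁.derivedPoint → ∀ (M₀ : ℕ),
          (∃ Q : (W.baseChange (ringClassField K ι 1)).toAffine.Point, ((2 ^ M₀ : ℕ) : ℤ) • Q = d₁.derivedPoint) →
          (¬ ∃ Q : (W.baseChange (ringClassField K ι 1)).toAffine.Point, ((2 ^ (M₀ + 1) : ℕ) : ℤ) • Q = d₁.derivedPoint) →
          2 * (M₀ : ℤ) ≤ (padicValNat 2 (Nat.card (AddCommGroup.primaryComponent (W.baseChange K).sha 2)) : ℤ) + 2 * padicValInt 2 Dt.c)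
    (hZ : S_rankZeroTwin) :
    ∀ (W : WeierstrassCurve ℚ) [W.IsElliptic] [W.IsGloballyMinimal], ¬ W.HasCM →
      (∀ n : ℕ, W.HasSurjectiveModNGaloisRep ((2 ^ n : ℕ) : ℤ)) → Odd W.torsionOrder → Odd W.tamagawaProduct →
      W.analyticRank = 1 → MissingLowerBoundAt W 2 := by
  intro W _ _ hCM hsurj _hT hc hr
  haveI hN : NeZero (W.conductorNorm ℤ) := ⟨(W.conductorNorm_pos_holds).ne'⟩
  have hmod : hasEntireLFunction_rat := hasEntireLFunction_rat_of_exists_isNewformOf hnf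
  obtain ⟨K, _iF, _iN, hK, hodd, h3, hH, hsq1, hsq2, Dt, β, ι, d₁, M₀, hy, hdiv, hndiv⟩ :=
    exists_kolyvaginDoorDatum_of_onSlice hGZ hnf hHL W hr
  have hshaL := hXL W hCM hsurj hc hr K hK hodd h3 hH hsq1 hsq2 Dt β ι d₁ hy M₀ hdiv hndiv
  exact missingLowerBoundAt_two_of_shaLowerC_at hGZ hGZK hmod hMilneC hZ W hCM hsurj hc hr K hK hodd h3 hH Dt β ι d₁ hy M₀ hdiv hndiv
    hshaL

/-! ### §3 The fkl residue (5b) BY NAME under the Euler-system half -/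

/-- **`RankOneAtTwoFkl.ShaAnTwoIntegralOnBigImageSlice` (the OPEN residue (5b) of the old fkl line: «`#Ш_an` is a `2`-adic integer on
the slice») FROM KOLYVAGIN'S UPPER BOUND AT `2` OVER `K`** (binder `hXU`), PRINT and `S_rankZeroTwin`: on the slice
`0 ≤ ord₂ #Ш(W) ≤ ord₂ #Ш_an(W)`.  Conditional by design; nothing asserted about `hXU`. [cite: GrossLMS1991, Thm. 1.3]
[cite: Miller2011LMS, Def. 1.1] -/
theorem shaAnTwoIntegralOnBigImageSlice_of_shaUpperCAtTwo
    (hGZ : ∀ (N : ℕ) [NeZero N] (W : WeierstrassCurve ℚ) (K : Type) [Field K] [NumberField K], gross_zagier N W K)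
    (hGZK : rank_eq_analyticRank_of_analyticRank_le_one) (hnf : exists_isNewformOf)
    (hHL : HoffsteinLuo1997_exists_twist_L_one_ne_zero) (hMilneC : Milne1972.bsdQuotient_baseChange_quadratic_anyModel)
    (hXU : ∀ (W : WeierstrassCurve ℚ) [W.IsElliptic] [W.IsGloballyMinimal] [NeZero (W.conductorNorm ℤ)],
      ¬ W.HasCM → (∀ n : ℕ, W.HasSurjectiveModNGaloisRep ((2 ^ n : ℕ) : ℤ)) → Odd W.tamagawaProduct → W.analyticRank = 1 →
      ∀ (K : Type) [Field K] [NumberField K], IsImaginaryQuadratic K → Odd (NumberField.discr K) →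
        NumberField.discr K ≠ -3 → SatisfiesHeegnerHypothesis (W.conductorNorm ℤ) K →
        ¬ IsSquare ((NumberField.discr K : ℚ) * -|W.Δ|) → ¬ IsSquare ((NumberField.discr K : ℚ) * (-(2 * |W.Δ|))) →
        ∀ (Dt : ModularParametrizationData W (W.conductorNorm ℤ)) (β : ℤ) (ι : K →+* ℂ) (d₁ : KolyvaginHeegnerData Dt β ι 1),
          ¬ IsOfFinAddOrder d₁.derivedPoint → ∀ (M₀ : ℕ),
          (∃ Q : (W.baseChange (ringClassField K ι 1)).toAffine.Point, ((2 ^ M₀ : ℕ) : ℤ) • Q = d₁.derivedPoint) →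
          (¬ ∃ Q : (W.baseChange (ringClassField K ι 1)).toAffine.Point, ((2 ^ (M₀ + 1) : ℕ) : ℤ) • Q = d₁.derivedPoint) →
          (padicValNat 2 (Nat.card (AddCommGroup.primaryComponent (W.baseChange K).sha 2)) : ℤ) + 2 * padicValInt 2 Dt.c ≤ 2 * M₀)
    (hZ : S_rankZeroTwin) : ShaAnTwoIntegralOnBigImageSlice := by
  intro W _ _ hCM hsurj hT hc hr q hq
  obtain ⟨q', hq', hle⟩ := missingUpperBoundAt_two_onSlice_of_shaUpperCAtTwo hGZ hGZK hnf hHL hMilneC hXU hZ W hCM hsurj hT hc hr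
  have hqq : q = q' := by exact_mod_cast hq.symm.trans hq'
  rw [hqq]
  exact le_trans (by exact_mod_cast Nat.zero_le _) hle

/-! ### §4 The crux BY NAME from the two one-sided binders -/

/-- **Crux `RankOneAtTwoBigImageOddLocal` BY NAME from PRINT + the two one-sided K-side binders `hXU`, `hXL` + `S_rankZeroTwin`**: both
halves hold on the slice (§2), so Miller's `BSD(W,2)` (`Typed.missingPPartAt_of_lower_of_upper`, `bsdp_of_missingPPartAt`; rank part and
finiteness by GZK).  Equivalent in content to g7's `rankOneAtTwoBigImageOddLocal_of_shaExactCAtTwo` (the exact binder is `hXU ∧ hXL`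
datum by datum); recorded so that the planner can file the halves as separate children.  Conditional by design; BSD is not proved.
[cite: GrossLMS1991, §2 Conj. (2.2) and §4] [cite: Miller2011LMS, Def. 1.1] -/
theorem rankOneAtTwoBigImageOddLocal_of_shaUpperC_of_shaLowerC
    (hGZ : ∀ (N : ℕ) [NeZero N] (W : WeierstrassCurve ℚ) (K : Type) [Field K] [NumberField K], gross_zagier N W K)
    (hGZK : rank_eq_analyticRank_of_analyticRank_le_one) (hnf : exists_isNewformOf)
    (hHL : HoffsteinLuo1997_exists_twist_L_one_ne_zero) (hMilneC : Milne1972.bsdQuotient_baseChange_quadratic_anyModel)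
    (hXU : ∀ (W : WeierstrassCurve ℚ) [W.IsElliptic] [W.IsGloballyMinimal] [NeZero (W.conductorNorm ℤ)],
      ¬ W.HasCM → (∀ n : ℕ, W.HasSurjectiveModNGaloisRep ((2 ^ n : ℕ) : ℤ)) → Odd W.tamagawaProduct → W.analyticRank = 1 →
      ∀ (K : Type) [Field K] [NumberField K], IsImaginaryQuadratic K → Odd (NumberField.discr K) →
        NumberField.discr K ≠ -3 → SatisfiesHeegnerHypothesis (W.conductorNorm ℤ) K →
        ¬ IsSquare ((NumberField.discr K : ℚ) * -|W.Δ|) → ¬ IsSquare ((NumberField.discr K : ℚ) * (-(2 * |W.Δ|))) →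
        ∀ (Dt : ModularParametrizationData W (W.conductorNorm ℤ)) (β : ℤ) (ι : K →+* ℂ) (d₁ : KolyvaginHeegnerData Dt β ι 1),
          ¬ IsOfFinAddOrder d₁.derivedPoint → ∀ (M₀ : ℕ),
          (∃ Q : (W.baseChange (ringClassField K ι 1)).toAffine.Point, ((2 ^ M₀ : ℕ) : ℤ) • Q = d₁.derivedPoint) →
          (¬ ∃ Q : (W.baseChange (ringClassField K ι 1)).toAffine.Point, ((2 ^ (M₀ + 1) : ℕ) : ℤ) • Q = d₁.derivedPoint) →
          (padicValNat 2 (Nat.card (AddCommGroup.primaryComponent (W.baseChange K).sha 2)) : ℤ) + 2 * padicValInt 2 Dt.c ≤ 2 * M₀)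
    (hXL : ∀ (W : WeierstrassCurve ℚ) [W.IsElliptic] [W.IsGloballyMinimal] [NeZero (W.conductorNorm ℤ)],
      ¬ W.HasCM → (∀ n : ℕ, W.HasSurjectiveModNGaloisRep ((2 ^ n : ℕ) : ℤ)) → Odd W.tamagawaProduct → W.analyticRank = 1 →
      ∀ (K : Type) [Field K] [NumberField K], IsImaginaryQuadratic K → Odd (NumberField.discr K) →
        NumberField.discr K ≠ -3 → SatisfiesHeegnerHypothesis (W.conductorNorm ℤ) K →
        ¬ IsSquare ((NumberField.discr K : ℚ) * -|W.Δ|) → ¬ IsSquare ((NumberField.discr K : ℚ) * (-(2 * |W.Δ|))) →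
        ∀ (Dt : ModularParametrizationData W (W.conductorNorm ℤ)) (β : ℤ) (ι : K →+* ℂ) (d₁ : KolyvaginHeegnerData Dt β ι 1),
          ¬ IsOfFinAddOrder d₁.derivedPoint → ∀ (M₀ : ℕ),
          (∃ Q : (W.baseChange (ringClassField K ι 1)).toAffine.Point, ((2 ^ M₀ : ℕ) : ℤ) • Q = d₁.derivedPoint) →
          (¬ ∃ Q : (W.baseChange (ringClassField K ι 1)).toAffine.Point, ((2 ^ (M₀ + 1) : ℕ) : ℤ) • Q = d₁.derivedPoint) →
          2 * (M₀ : ℤ) ≤ (padicValNat 2 (Nat.card (AddCommGroup.primaryComponent (W.baseChange K).sha 2)) : ℤ) + 2 * padicValInt 2 Dt.c)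
    (hZ : S_rankZeroTwin) : RankOneAtTwoBigImageOddLocal := by
  intro W _ _ hCM hsurj hT hc hr
  haveI : Fact (Nat.Prime 2) := ⟨Nat.prime_two⟩
  exact bsdp_of_missingPPartAt W 2 hGZK hr.le (missingPPartAt_of_lower_of_upper W 2
    (missingLowerBoundAt_two_onSlice_of_shaLowerCAtTwo hGZ hGZK hnf hHL hMilneC hXL hZ W hCM hsurj hT hc hr)
    (missingUpperBoundAt_two_onSlice_of_shaUpperCAtTwo hGZ hGZK hnf hHL hMilneC hXU hZ W hCM hsurj hT hc hr))


end Summit.BirchSwinnertonDyer.BirchSwinnertonDyer.Theorems.RankOneAtTwoOneDoor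

end
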